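import Mathlib
import Summits.ValiantsHypothesis.ValiantsHypothesis.Theorems.KPlusLogSqLawWeakLiftingTowerGraftSizeSuperadditive
import Summits.ValiantsHypothesis.ValiantsHypothesis.Theorems.KPlusLogSqLawWeakLiftingTowerGraftTowerTwoSidedWitnessTen
import Summits.ValiantsHypothesis.ValiantsHypothesis.Theorems.LacunarySymmetroidMatrixDescartesStubReverse

/-!
# Tower graft line — size superadditivity INSIDE THE TWO-SIDED WORD CLASS (wrapper of `…SizeSuperadditive`)

Crux `stmt-ValiantsHypothesis-19561` (`Theses.KPlusLogSqLaw.WeakLifting`), line (B) `Cruxes/WeakLifting/Lines/tower_graft.lean`.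
`…TowerGraftSizeSuperadditive` proves `ζ₊(m₁ + m₂; d) ≥ ζ₊(m₁; d) + ζ₊(m₂; d)` in CENSUS currency (`PosRootLawOn`: all symmetric
letters).  The line's tower column `2 · 6 · 10` (`T₂₄` p675647, `T₁₀` p681233) and the kill templates #37′/#37″ live in the narrower
TWO-SIDED WORD class `X^e • J + ∑ₖ X^{dₖ} • Pₖ` (`Pₖ ⪰ 0`, ONE symmetric pivot `J`; `stub_twoSided` currency).  This wrapper (desk R2908 /
crit-6 price (W), option (a)) states superadditivity inside that class: the block-diagonal direct sum of two words on the same support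
(same pivot exponent `e`, same `d`), with the second word's letters rescaled by `μ^{e}`, `μ^{d k}`, is again a word of the class —
`Pₖ = P₁ₖ ⊕ μ^{dₖ}P₂ₖ ⪰ 0` (`SizeSuperadditive.posSemidef_blockDiag`), `J = J₁ ⊕ μ^{e}J₂` symmetric — on the SAME support (so towers stay
towers and two-sidedness is kept), and for a suitable `μ > 0` its positive-root count is at least the sum of the two
(`exists_blockDiag_word_card_posRoots_ge`, from `SizeSuperadditive.exists_blockDiag_card_posRoots_ge` by re-keying the word as a letter
family over `Fin (K+1)`, `pencil_word_eq_sum`).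

Application — **TOWER TWELVE AT `m = 4` IN THE WORD CLASS** (`exists_tower_twoSided_card_ge_twelve_four`): `T₁₀` (`m = 3`, `Z₊ ≥ 10` on
`(0,1,5,25)`, pivot exponent `1`) ⊕ the `1 × 1` word `1 − 3X + X⁵ + X²⁵` (`Z₊ ≥ 2`) is a four-letter two-sided `4 × 4` word on the genuine
4-TOWER `(0,1,5,25)` with `Z₊ ≥ 12 = 3m` — the free direct-sum floor of the cell's m-column (`2, 6, 10, ≥ 12`); the line's located
prediction for a COUPLED witness at `m = 4` is `14 = 4m − 2` (crit-6 ACK #25), not claimed here.  Def-free.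

HONEST FRAMING: bookkeeping wrapper (block-diagonal direct sums); proves nothing about `WeakLifting`, Conjecture B / `KPlusLogSqLaw`,
the registered stubs S4/S4b/S4d/S4f/S5/S5ᴸ, `MatrixDescartes` (18050) or `VP ≠ VNP`.  Seat: prover val-sym-lift-p3 g19,
`--supports stmt-ValiantsHypothesis-19561`.

[folklore] Elementary linear algebra.
-/

-- `Summit.ValiantsHypothesis.ValiantsHypothesis.…` repeats a component by the D-0017 layout
-- (single-conjunct summit), which the `dupNamespace` linter flags; the name is mandated.
set_option linter.dupNamespace false

namespace Summit.ValiantsHypothesis.ValiantsHypothesis.Theorems.KPlusLogSqLaw.TowerGraft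

open Finset Polynomial Matrix
open scoped BigOperators Polynomial
open Summit.ValiantsHypothesis.ValiantsHypothesis.Theorems.LacunarySymmetroidMatrixDescartes (StubReverse.eval_det_pencil)
open Summit.ValiantsHypothesis.ValiantsHypothesis.Theorems.SymmetroidDescartes (le_card_posRoots_of_alternating)

namespace SizeSuperadditiveWord

variable {m₁ m₂ m K : ℕ}

/-- The pivot word `X^e • J + ∑ₖ X^{dₖ} • Pₖ` is the lacunary pencil of the letter family `Fin.cons J P` on the support `Fin.cons e d`.
[folklore] -/
theorem pencil_word_eq_sum (e : ℕ) (d : Fin K → ℕ) (J : Matrix (Fin m) (Fin m) ℝ) (P : Fin K → Matrix (Fin m) (Fin m) ℝ) :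
    ((X : ℝ[X]) ^ e) • J.map C + ∑ k, ((X : ℝ[X]) ^ d k) • (P k).map C
      = ∑ l, ((X : ℝ[X]) ^ (Fin.cons e d : Fin (K + 1) → ℕ) l) •
          ((Fin.cons J P : Fin (K + 1) → Matrix (Fin m) (Fin m) ℝ) l).map C := by
  rw [Fin.sum_univ_succ]
  simp only [Fin.cons_zero, Fin.cons_succ]

/-- **Superadditivity inside the two-sided word class.**  For two words `X^e • Jᵢ + ∑ₖ X^{dₖ} • Pᵢₖ` (`i = 1, 2`) on the same support
with non-zero determinants there is `μ > 0` such that the block-diagonal word with pivot `J₁ ⊕ μ^e J₂` and letters `P₁ₖ ⊕ μ^{dₖ} P₂ₖ`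
(re-indexed to `Fin (m₁ + m₂)`) has at least as many distinct positive roots of its determinant as the two words together. [folklore] -/
theorem exists_blockDiag_word_card_posRoots_ge (e : ℕ) (d : Fin K → ℕ)
    (J₁ : Matrix (Fin m₁) (Fin m₁) ℝ) (P₁ : Fin K → Matrix (Fin m₁) (Fin m₁) ℝ)
    (J₂ : Matrix (Fin m₂) (Fin m₂) ℝ) (P₂ : Fin K → Matrix (Fin m₂) (Fin m₂) ℝ)
    (h₁ : Matrix.det (((X : ℝ[X]) ^ e) • J₁.map C + ∑ k, ((X : ℝ[X]) ^ d k) • (P₁ k).map C) ≠ 0)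
    (h₂ : Matrix.det (((X : ℝ[X]) ^ e) • J₂.map C + ∑ k, ((X : ℝ[X]) ^ d k) • (P₂ k).map C) ≠ 0) :
    ∃ μ : ℝ, 0 < μ ∧
      ((Matrix.det (((X : ℝ[X]) ^ e) • J₁.map C + ∑ k, ((X : ℝ[X]) ^ d k) • (P₁ k).map C)).roots.toFinset.filter
            (fun t => 0 < t)).card +
          ((Matrix.det (((X : ℝ[X]) ^ e) • J₂.map C + ∑ k, ((X : ℝ[X]) ^ d k) • (P₂ k).map C)).roots.toFinset.filter
            (fun t => 0 < t)).card ≤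
        ((Matrix.det (((X : ℝ[X]) ^ e) •
              (Matrix.reindex finSumFinEquiv finSumFinEquiv (Matrix.fromBlocks J₁ 0 0 (μ ^ e • J₂))).map C +
            ∑ k, ((X : ℝ[X]) ^ d k) •
              (Matrix.reindex finSumFinEquiv finSumFinEquiv
                (Matrix.fromBlocks (P₁ k) 0 0 (μ ^ d k • P₂ k))).map C)).roots.toFinset.filter (fun t => 0 < t)).card := by
  rw [pencil_word_eq_sum] at h₁ h₂
  obtain ⟨μ, hμ, hle⟩ := SizeSuperadditive.exists_blockDiag_card_posRoots_ge (Fin.cons e d : Fin (K + 1) → ℕ)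
    (Fin.cons J₁ P₁) (Fin.cons J₂ P₂) h₁ h₂
  refine ⟨μ, hμ, ?_⟩
  rw [pencil_word_eq_sum, pencil_word_eq_sum, pencil_word_eq_sum]
  have hsum : (∑ l, ((X : ℝ[X]) ^ (Fin.cons e d : Fin (K + 1) → ℕ) l) •
      ((Fin.cons (Matrix.reindex finSumFinEquiv finSumFinEquiv (Matrix.fromBlocks J₁ 0 0 (μ ^ e • J₂)))
          (fun k => Matrix.reindex finSumFinEquiv finSumFinEquiv (Matrix.fromBlocks (P₁ k) 0 0 (μ ^ d k • P₂ k))) :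
            Fin (K + 1) → Matrix (Fin (m₁ + m₂)) (Fin (m₁ + m₂)) ℝ) l).map C)
      = ∑ l, ((X : ℝ[X]) ^ (Fin.cons e d : Fin (K + 1) → ℕ) l) •
          (Matrix.reindex finSumFinEquiv finSumFinEquiv
            (Matrix.fromBlocks ((Fin.cons J₁ P₁ : Fin (K + 1) → Matrix (Fin m₁) (Fin m₁) ℝ) l) 0 0
              (μ ^ (Fin.cons e d : Fin (K + 1) → ℕ) l •
                (Fin.cons J₂ P₂ : Fin (K + 1) → Matrix (Fin m₂) (Fin m₂) ℝ) l))).map C := by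
    refine Finset.sum_congr rfl fun l _ => ?_
    refine Fin.cases ?_ (fun k => ?_) l
    · simp only [Fin.cons_zero]
    · simp only [Fin.cons_succ]
  rw [hsum]
  exact hle

/-- The block-diagonal PSD letters are PSD (`μ > 0`). [folklore] -/
theorem posSemidef_blockDiag_smul {A : Matrix (Fin m₁) (Fin m₁) ℝ} {D : Matrix (Fin m₂) (Fin m₂) ℝ} (hA : A.PosSemidef)
    (hD : D.PosSemidef) {μ : ℝ} (hμ : 0 ≤ μ) (n : ℕ) :
    (Matrix.reindex finSumFinEquiv finSumFinEquiv (Matrix.fromBlocks A 0 0 (μ ^ n • D))).PosSemidef :=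
  SizeSuperadditive.posSemidef_blockDiag hA (hD.smul (pow_nonneg hμ n))

/-- The block-diagonal pivot is symmetric. [folklore] -/
theorem isSymm_blockDiag_smul {A : Matrix (Fin m₁) (Fin m₁) ℝ} {D : Matrix (Fin m₂) (Fin m₂) ℝ} (hA : A.IsSymm) (hD : D.IsSymm)
    (c : ℝ) : (Matrix.reindex finSumFinEquiv finSumFinEquiv (Matrix.fromBlocks A 0 0 (c • D))).IsSymm :=
  SizeSuperadditive.isSymm_blockDiag hA (hD.smul c)

end SizeSuperadditiveWord

open SizeSuperadditiveWord TowerTwoSidedWitnessTen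

/-- The `1 × 1` two-sided word `X¹ • (−3) + X⁰ • 1 + X⁵ • 1 + X²⁵ • 1` on `T₁₀`'s support `(0,1,5,25)` (pivot exponent `e₁₀ = 1`, PSD
exponents `d₁₀ = (0,5,25)`) has at least two positive roots (signs `+, −, +` at `1/4, 1/2, 2`; the Descartes-sharp `m = 1` cell). -/
theorem two_le_card_posRoots_word_one :
    2 ≤ ((Matrix.det (((X : ℝ[X]) ^ e₁₀) • (!![(-3 : ℝ)]).map C +
        ∑ k, ((X : ℝ[X]) ^ d₁₀ k) • (1 : Matrix (Fin 1) (Fin 1) ℝ).map C)).roots.toFinset.filter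
          (fun t => 0 < t)).card := by
  refine le_card_posRoots_of_alternating _ 2 ![1/4, 1/2, 2] ?_ ?_ ?_
  · refine Fin.strictMono_iff_lt_succ.2 fun j => ?_
    fin_cases j <;> simp <;> norm_num
  · intro j; fin_cases j <;> simp
  · intro j
    fin_cases j <;> rw [StubReverse.eval_det_pencil, StubReverse.eval_det_pencil] <;>
      simp [Matrix.det_unique, Fin.sum_univ_three, e₁₀, d₁₀] <;> norm_num

/-- **TOWER TWELVE AT `m = 4` IN THE TWO-SIDED WORD CLASS (kernel floor by direct sum).**  There is a four-letter two-sided `4 × 4` word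
`X^e • J + ∑ₖ X^{dₖ} • Pₖ` (`J` symmetric, `Pₖ ⪰ 0` on both sides of the pivot) on a genuine 4-TOWER support (`4·x < y` pairwise;
it is `(0, 1, 5, 25)` with the pivot at `1`) with at least `12 = 3·4` distinct positive zeros of its determinant:
`T₁₀ ⊕ μ·(1 − 3X + X⁵ + X²⁵)`. -/
theorem exists_tower_twoSided_card_ge_twelve_four :
    ∃ (e : ℕ) (d : Fin 3 → ℕ) (J : Matrix (Fin 4) (Fin 4) ℝ) (P : Fin 3 → Matrix (Fin 4) (Fin 4) ℝ),
      J.IsSymm ∧ (∀ k, (P k).PosSemidef) ∧ (∃ k, d k < e) ∧ (∃ k, e < d k) ∧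
        (∀ k, d k < e → 4 * d k < e) ∧ (∀ k, e < d k → 4 * e < d k) ∧ (∀ k k', d k < d k' → 4 * d k < d k') ∧
        12 ≤ ((Matrix.det (((X : ℝ[X]) ^ e) • J.map Polynomial.C
              + ∑ k, ((X : ℝ[X]) ^ d k) • (P k).map Polynomial.C)).roots.toFinset.filter
                (fun t => 0 < t)).card := by
  have h10 := ten_le_card_posRoots_T₁₀
  unfold T₁₀ at h10
  have h2 := two_le_card_posRoots_word_one
  have hne₁ : Matrix.det (((X : ℝ[X]) ^ e₁₀) • J₁₀.map C + ∑ k, ((X : ℝ[X]) ^ d₁₀ k) • (P₁₀ k).map C) ≠ 0 := by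
    intro h; rw [h] at h10; simp at h10
  have hne₂ : Matrix.det (((X : ℝ[X]) ^ e₁₀) • (!![(-3 : ℝ)]).map C +
      ∑ k, ((X : ℝ[X]) ^ d₁₀ k) • (1 : Matrix (Fin 1) (Fin 1) ℝ).map C) ≠ 0 := by
    intro h; rw [h] at h2; simp at h2
  obtain ⟨μ, hμ, hle⟩ := exists_blockDiag_word_card_posRoots_ge e₁₀ d₁₀ J₁₀ P₁₀ (!![(-3 : ℝ)])
    (fun _ : Fin 3 => (1 : Matrix (Fin 1) (Fin 1) ℝ)) hne₁ hne₂
  have hJ₂ : (!![(-3 : ℝ)] : Matrix (Fin 1) (Fin 1) ℝ).IsSymm := Matrix.IsSymm.ext fun i j => by rw [Subsingleton.elim i j]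
  refine ⟨e₁₀, d₁₀, _, _, isSymm_blockDiag_smul J₁₀_isSymm hJ₂ _,
    fun k => posSemidef_blockDiag_smul (P₁₀_posSemidef k) Matrix.PosDef.one.posSemidef hμ.le _,
    twoSided₁₀.1, twoSided₁₀.2, ?_, ?_, ?_, le_trans (by omega) hle⟩
  · intro k; fin_cases k <;> simp [d₁₀, e₁₀]
  · intro k; fin_cases k <;> simp [d₁₀, e₁₀]
  · intro k k'; fin_cases k <;> fin_cases k' <;> simp [d₁₀]

end Summit.ValiantsHypothesis.ValiantsHypothesis.Theorems.KPlusLogSqLaw.TowerGraft
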